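import Summits.CriticalPhenomena.SAWScalingLimit.Theorems.SAWLoopFugacityFlowAvoidanceLimitCritLineWellPosed
import Summits.CriticalPhenomena.SAWScalingLimit.Theorems.SAWLoopFugacityFlowAvoidanceLimitDeterminantalConfigs
import Summits.CriticalPhenomena.SAWScalingLimit.Theorems.SAWLoopFugacityFlowAvoidanceLimitDeterminantalStrands
import Summits.CriticalPhenomena.SAWScalingLimit.Theorems.SAWLoopFugacityFlowAvoidanceLimitDeterminantalLoops

/-!
# The loop gas only lowers the two-leg function: `critLine 0 ≤ critLine n` for `n ≥ 0` — helper of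
stub `stub_positiveFugacityLimits` (line `saw-corner-germ`, crux `SAWLoopFugacityFlow.AvoidanceLimit`,
stmt-CriticalPhenomena-10649)

For the strictly dilute loop-dressed SAW (`t = 0` slice `dimerPF n 0 y` of the Anchor objects = the
tree's `DiluteLoopModel ⟨n, 0, y⟩`) with NONNEGATIVE loop fugacity `n` and edge fugacity `y` on a
subgraph `H ≤ ℤ²`:

* `partitionFunction_dilute_eq_sum`: at collision weight `0` only the collision-free configurations
  survive, `Z_{n,0,y}(S; A) = Σ_{F ∈ cfC} y^{|F|} n^{loops F}`;
* `sdiff_path_mem_cfConfigs`, `card_eq_length_add_card_sdiff`, `loops_eq_loops_sdiff_path`: a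
  collision-free two-source configuration is its open strand `γ` (a self-avoiding path from `a` to `b`,
  `DetExpansion.exists_path_of_mem_cfConfigs`) plus a source-free collision-free configuration on the
  vertices off `γ`, with `|F| = |γ| + |F ∖ γ|` and `loops F = loops (F ∖ γ)`
  (`loops_union_of_vertexDisjoint`, `DetExpansion.loops_path_eq_zero`);
* `partitionFunction_two_le`: hence `Z_{n,0,y}(S; a, b) ≤ (Σ_γ y^{|γ|}) · Z_{n,0,y}(S; ∅)` — drop the
  constraint that the loops avoid `γ` (all weights are `≥ 0`);
* `twoLegDim_le_twoLegDim_zero` (registered): `twoLegDim n 0 y ≤ twoLegDim 0 0 y = Σ_γ y^{|γ|}` —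
  switching on a nonnegative loop fugacity can only LOWER the normalised two-leg function;
* `isMassive_of_isMassive_zero`, `critLine_zero_le_critLine` (registered, UNFOLDED into tree
  vocabulary): consequently every edge fugacity that is massive for the pure SAW (`n = 0`) is massive
  for every `n ≥ 0`, and the line's critical curve satisfies `critLine 0 ≤ critLine n` for `n ≥ 0` — with
  the line's stubs `massiveBelow`/`notMassiveAt` (`critLine 0 = 1/μ`) this puts `critLine n ≥ 1/μ > 0`,
  so `lineRatio … δ n` is evaluated at a POSITIVE edge fugacity, where its denominators are honest
  (`twoLegDim_discreteDomain_pos`).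

Sources: N. Madras, G. Slade, *The Self-Avoiding Walk* (1993), §1.2 [MadrasSlade1993]; W. Guo,
H. Blöte, B. Nienhuis, Int. J. Mod. Phys. C 10 (1999) 301, §1 eq. (1), §2 [GuoBloteNienhuis1999].
No definitions; no statement of the line is asserted here.
-/

noncomputable section

open Filter Topology
open scoped BigOperators symmDiff
open Finset
open Literature.Probability.RandomPlanarGeometry Literature.Probability.LatticeModels
open Summit.CriticalPhenomena.SAWScalingLimit.Theorems.AvoidanceLimit.Anchor

namespace Summit.CriticalPhenomena.SAWScalingLimit.Theorems.AvoidanceLimit.Corner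

section LoopGasLowers

open DiluteLoopModel SimpleGraph DetExpansion

variable {H : SimpleGraph (Site 2)}

/-- `|F| = |γ| + |F ∖ γ|` for the open strand `γ ⊆ F`. [folklore] -/
theorem card_eq_length_add_card_sdiff {a b : Site 2} {F : Finset (Sym2 (Site 2))} {p : H.Walk a b}
    (hp : p.IsPath) (hpE : p.edges.toFinset ⊆ F) : #F = p.length + #(F \ p.edges.toFinset) := by
  rw [← card_sdiff_add_card_eq_card hpE, IsPath.card_edges_toFinset hp, add_comm]

/-- **The open strand carries no closed strand**: `loops F = loops (F ∖ γ)` (additivity over the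
vertex-disjoint union `F = γ ⊔ (F ∖ γ)`, `loops γ = 0`). [folklore] -/
theorem loops_eq_loops_sdiff_path (hH : H ≤ zdGraph 2) {S : Finset (Site 2)} {a b : Site 2}
    {F : Finset (Sym2 (Site 2))} {p : H.Walk a b} (hp : p.IsPath) (ha : a ∈ S)
    (hpE : p.edges.toFinset ⊆ F)
    (havoid : ∀ e ∈ F, e ∉ p.edges.toFinset → ∀ z ∈ p.support, z ∉ e) :
    loops S F ∅ = loops S (F \ p.edges.toFinset) ∅ := by
  conv_lhs => rw [← union_sdiff_of_subset hpE]
  rw [loops_union_of_vertexDisjoint S _ _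
      (vdisjoint_path_sdiff havoid (mem_support_of_mem_edges_toFinset p)),
    loops_path_eq_zero hH hp ha, zero_add]

variable [H.LocallyFinite]

/-- **At collision weight `0` only collision-free configurations survive**:
`Z_{n,0,y}(S; A) = Σ_{F ∈ cfC} y^{|F|} n^{loops(F)}` (trivial resolution). [cite: GuoBloteNienhuis1999, §1 eq. (1)] -/
theorem partitionFunction_dilute_eq_sum {R : Type*} [CommSemiring R] (n y : R)
    (S A : Finset (Site 2)) :
    (⟨n, 0, y⟩ : DiluteLoopModel R).partitionFunction H S A =
      ∑ F ∈ ((configs H S A).filter fun F => oscVerts S F = ∅), y ^ #F * n ^ loops S F ∅ := by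
  rw [partitionFunction, sum_filter]
  refine sum_congr rfl fun F _ => ?_
  by_cases hosc : oscVerts S F = ∅
  · rw [if_pos hosc]
    simp only [weight, hosc, Finset.powerset_empty, Finset.sum_singleton, Finset.card_empty, pow_zero,
      mul_one]
  · rw [if_neg hosc]
    refine sum_eq_zero fun T _ => ?_
    have : #(oscVerts S F) ≠ 0 := by rwa [ne_eq, card_eq_zero]
    simp [weight, zero_pow this]

/-- **Removing the open strand leaves a source-free collision-free configuration**: if the
self-avoiding path `p` from `a` to `b` has its edges in the collision-free two-source configuration
`F` and no other edge of `F` touches `p`, then `F ∖ p` is collision-free and source-free (degree `0`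
on `p`, unchanged degree `0` or `2` off `p`). [folklore] -/
theorem sdiff_path_mem_cfConfigs (hH : H ≤ zdGraph 2) {S : Finset (Site 2)} {a b : Site 2}
    {F : Finset (Sym2 (Site 2))}
    (hF : F ∈ ((configs H S ({a} ∆ {b})).filter fun F => oscVerts S F = ∅)) {p : H.Walk a b}
    (havoid : ∀ e ∈ F, e ∉ p.edges.toFinset → ∀ z ∈ p.support, z ∉ e) :
    F \ p.edges.toFinset ∈ ((configs H S ∅).filter fun F => oscVerts S F = ∅) := by
  obtain ⟨hsub, hAS, hdeg⟩ := (mem_cfConfigs_iff hH).1 hF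
  refine (mem_cfConfigs_iff hH).2 ⟨fun e he => hsub (Finset.mem_sdiff.1 he).1, Finset.empty_subset _,
    fun z hz => ⟨fun h => absurd h (notMem_empty z), fun _ => ?_⟩⟩
  by_cases hzp : z ∈ p.support
  · -- every edge of `F` at a vertex of the strand is an edge of the strand
    refine Or.inl (deg_eq_zero_iff.2 fun e he hze => ?_)
    obtain ⟨heF, heP⟩ := Finset.mem_sdiff.1 he
    exact havoid e heF heP z hzp hze
  · -- off the strand the degree is unchanged, and `z` is not a source
    have hzA : z ∉ ({a} ∆ {b} : Finset (Site 2)) := by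
      intro h
      rw [Finset.mem_symmDiff, Finset.mem_singleton, Finset.mem_singleton] at h
      rcases h with ⟨rfl, -⟩ | ⟨rfl, -⟩
      · exact hzp p.start_mem_support
      · exact hzp p.end_mem_support
    have hfilter : (F \ p.edges.toFinset).filter (fun e => z ∈ e) = F.filter fun e => z ∈ e := by
      ext e
      simp only [Finset.mem_filter, Finset.mem_sdiff]
      constructor
      · rintro ⟨⟨heF, -⟩, hze⟩
        exact ⟨heF, hze⟩
      · rintro ⟨heF, hze⟩
        exact ⟨⟨heF, fun heP => hzp (mem_support_of_mem_edges_toFinset p e heP z hze)⟩, hze⟩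
    rw [hfilter]
    exact (hdeg z hz).2 hzA

/-- **The loop gas only lowers the two-leg partition function**: for `n, y ≥ 0` and `a ≠ b`,
`Z_{n,0,y}(S; a, b) ≤ (Σ_{γ ∈ pathsIn H S a b} y^{|γ|}) · Z_{n,0,y}(S; ∅)` — decompose each
configuration into its open strand `γ` and a source-free configuration off `γ`
(`(γ, F ∖ γ)` is injective), then forget that the latter avoids `γ` (nonnegative weights).
[cite: MadrasSlade1993, §1.2] -/
theorem partitionFunction_two_le (hH : H ≤ zdGraph 2) {n y : ℝ} (hn : 0 ≤ n) (hy : 0 ≤ y)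
    (S : Finset (Site 2)) {a b : Site 2} (hab : a ≠ b) :
    (⟨n, 0, y⟩ : DiluteLoopModel ℝ).partitionFunction H S ({a} ∆ {b}) ≤
      (∑ p ∈ pathsIn H S a b, y ^ p.length) *
        (⟨n, 0, y⟩ : DiluteLoopModel ℝ).partitionFunction H S ∅ := by
  classical
  rw [partitionFunction_dilute_eq_sum, partitionFunction_dilute_eq_sum, sum_mul_sum, ← sum_product']
  set C := ((configs H S ({a} ∆ {b})).filter fun F => oscVerts S F = ∅) with hC
  -- the open strand of each configuration
  have key : ∀ F : {F // F ∈ C}, ∃ p : H.Walk a b, p.IsPath ∧ (∀ z ∈ p.support, z ∈ S) ∧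
      p.edges.toFinset ⊆ F.1 ∧ ∀ e ∈ F.1, e ∉ p.edges.toFinset → ∀ z ∈ p.support, z ∉ e :=
    fun F => exists_path_of_mem_cfConfigs hH _ F.1 a rfl hab F.2
  choose path hpath hS hE havoid using key
  set g : H.Walk a b × Finset (Sym2 (Site 2)) → ℝ :=
    fun q => y ^ q.1.length * (y ^ #q.2 * n ^ loops S q.2 ∅) with hg
  set φ : {F // F ∈ C} → H.Walk a b × Finset (Sym2 (Site 2)) :=
    fun F => (path F, F.1 \ (path F).edges.toFinset) with hφ
  have hinj : ∀ F₁ ∈ C.attach, ∀ F₂ ∈ C.attach, φ F₁ = φ F₂ → F₁ = F₂ := by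
    intro F₁ _ F₂ _ h
    obtain ⟨h1, h2⟩ := Prod.mk.inj h
    apply Subtype.ext
    calc F₁.1 = (path F₁).edges.toFinset ∪ (F₁.1 \ (path F₁).edges.toFinset) :=
        (union_sdiff_of_subset (hE F₁)).symm
      _ = (path F₂).edges.toFinset ∪ (F₂.1 \ (path F₂).edges.toFinset) := by rw [h2, h1]
      _ = F₂.1 := union_sdiff_of_subset (hE F₂)
  have hweight : ∀ F : {F // F ∈ C}, y ^ #F.1 * n ^ loops S F.1 ∅ = g (φ F) := by
    intro F
    have ha : a ∈ S := hS F a (path F).start_mem_support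
    simp only [hg, hφ]
    rw [card_eq_length_add_card_sdiff (hpath F) (hE F),
      loops_eq_loops_sdiff_path hH (hpath F) ha (hE F) (havoid F), pow_add, mul_assoc]
  have himage :
      C.attach.image φ ⊆ pathsIn H S a b ×ˢ ((configs H S ∅).filter fun F => oscVerts S F = ∅) := by
    rw [Finset.image_subset_iff]
    intro F _
    exact mem_product.2 ⟨mem_pathsIn.2 ⟨hpath F, hS F⟩, sdiff_path_mem_cfConfigs hH F.2 (havoid F)⟩
  calc ∑ F ∈ C, y ^ #F * n ^ loops S F ∅
      = ∑ F ∈ C.attach, y ^ #F.1 * n ^ loops S F.1 ∅ := (sum_attach C _).symm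
    _ = ∑ F ∈ C.attach, g (φ F) := sum_congr rfl fun F _ => hweight F
    _ = ∑ q ∈ C.attach.image φ, g q := (sum_image hinj).symm
    _ ≤ ∑ q ∈ pathsIn H S a b ×ˢ ((configs H S ∅).filter fun F => oscVerts S F = ∅), g q :=
        sum_le_sum_of_subset_of_nonneg himage fun q _ _ =>
          mul_nonneg (pow_nonneg hy _) (mul_nonneg (pow_nonneg hy _) (pow_nonneg hn _))
    _ = ∑ q ∈ pathsIn H S a b ×ˢ ((configs H S ∅).filter fun F => oscVerts S F = ∅),
          y ^ q.1.length * (y ^ #q.2 * n ^ loops S q.2 ∅) := rfl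

/-- **Registered helper · switching on a nonnegative loop fugacity only LOWERS the normalised two-leg
function**: `twoLegDim n 0 y H S a b ≤ twoLegDim 0 0 y H S a b (= Σ_γ y^{|γ|})` for `n, y ≥ 0` on
`H ≤ ℤ²` (both sides are `1` when `a = b`). [cite: MadrasSlade1993, §1.2] -/
theorem twoLegDim_le_twoLegDim_zero :
    ∀ (H : SimpleGraph (Site 2)) [H.LocallyFinite], H ≤ zdGraph 2 → ∀ (n y : ℝ), 0 ≤ n → 0 ≤ y →
      ∀ (S : Finset (Site 2)) (a b : Site 2), twoLegDim n 0 y H S a b ≤ twoLegDim 0 0 y H S a b := by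
  intro H _ hH n y hn hy S a b
  by_cases hab : a = b
  · subst hab
    rw [twoLegDim_dimerFugacity_zero, twoLegDim_dimerFugacity_zero,
      twoLeg_self S a (partitionFunction_empty_pos (L := ⟨n, 0, y⟩) hn le_rfl hy S).ne',
      twoLeg_self S a (partitionFunction_empty_pos (L := ⟨0, 0, y⟩) le_rfl le_rfl hy S).ne']
  · rw [twoLegDim_dimerFugacity_zero, twoLegDim_zero_zero_eq_sum_paths hH y S hab, twoLeg,
      div_le_iff₀ (partitionFunction_empty_pos (L := ⟨n, 0, y⟩) hn le_rfl hy S)]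
    exact partitionFunction_two_le hH hn hy S hab

end LoopGasLowers

/-! ## Consequences for the line's massiveness and critical curve (UNFOLDED into tree vocabulary) -/

/-- **Massive for the pure SAW ⟹ massive for every nonnegative loop fugacity**: if the
corner-to-corner SAW generating function of `[0, k]²` at edge fugacity `y ≥ 0` is `≤ e^{-mk}` eventually,
so is the two-leg function of the loop-dressed SAW at every `n ≥ 0` (same rate). [cite: MadrasSlade1993, §1.2] -/
theorem isMassive_of_isMassive_zero :
    ∀ (n y : ℝ), 0 ≤ n → 0 ≤ y →
      (∃ m : ℝ, 0 < m ∧ ∀ᶠ k : ℕ in atTop,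
        twoLegDim (0 : ℝ) 0 y (zdGraph 2) ((box 2 k).filter fun v => ∀ i, 0 ≤ v i) 0 (SAW.diag k) ≤
          Real.exp (-(m * k))) →
      ∃ m : ℝ, 0 < m ∧ ∀ᶠ k : ℕ in atTop,
        twoLegDim n 0 y (zdGraph 2) ((box 2 k).filter fun v => ∀ i, 0 ≤ v i) 0 (SAW.diag k) ≤
          Real.exp (-(m * k)) := by
  rintro n y hn hy ⟨m, hm, hev⟩
  refine ⟨m, hm, hev.mono fun k hk => ?_⟩
  exact (twoLegDim_le_twoLegDim_zero (zdGraph 2) le_rfl n y hn hy _ 0 (SAW.diag k)).trans hk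

/-- **Registered helper · `critLine 0 ≤ critLine n` for `n ≥ 0`** (UNFOLDED): the initial massive
interval of the pure SAW is contained in that of the loop-dressed SAW at every nonnegative loop
fugacity, so the suprema compare (both sets are non-empty and bounded by `1`,
`critLineSet_nonempty` / `critLineSet_bddAbove`). With the line's `critLine 0 = 1/μ` this gives
`critLine n ≥ 1/μ > 0`. [cite: MadrasSlade1993, §1.2] -/
theorem critLine_zero_le_critLine :
    ∀ n : ℝ, 0 ≤ n →
      sSup {x : ℝ | 0 ≤ x ∧ x ≤ 1 ∧ ∀ y ∈ Set.Icc 0 x, ∃ m : ℝ, 0 < m ∧ ∀ᶠ k : ℕ in atTop,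
        twoLegDim (0 : ℝ) 0 y (zdGraph 2) ((box 2 k).filter fun v => ∀ i, 0 ≤ v i) 0 (SAW.diag k) ≤
          Real.exp (-(m * k))} ≤
      sSup {x : ℝ | 0 ≤ x ∧ x ≤ 1 ∧ ∀ y ∈ Set.Icc 0 x, ∃ m : ℝ, 0 < m ∧ ∀ᶠ k : ℕ in atTop,
        twoLegDim n 0 y (zdGraph 2) ((box 2 k).filter fun v => ∀ i, 0 ≤ v i) 0 (SAW.diag k) ≤
          Real.exp (-(m * k))} := by
  intro n hn
  refine csSup_le_csSup (critLineSet_bddAbove n) (critLineSet_nonempty 0) ?_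
  rintro x ⟨hx0, hx1, hx⟩
  exact ⟨hx0, hx1, fun y hy => isMassive_of_isMassive_zero n y hn hy.1 (hx y hy)⟩

end Summit.CriticalPhenomena.SAWScalingLimit.Theorems.AvoidanceLimit.Corner

end
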